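import Summits.Ventures.PercRepro2.CaseOneStar

/-!
# The marked star: the quadruple pinning
(blind cell PercRepro2, p1 g15; S5 §2.1 (K9) (p), proofs/P1-TWOMARK.md §4)

`pin4 p = p[e₁ ↦ 0][e₂ ↦ 0][eo ↦ 0][eb ↦ 0]`; `expect_fourPin`: `E_p[f]` as the sixteen-term mixture over
the states of the four edges at `a₃`, each term an expectation under `pin4 p` of `f` at the re-opened
configuration `open4`; `prob_fourPin`: the same for probabilities, given the sixteen pointwise
descriptions on the closed configurations. -/

namespace Summit.Ventures.PercRepro2

namespace CaseOne

section Pin4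
variable {V : Type*} {E : Type*} [Fintype E] [DecidableEq E] {R : Type*} [CommRing R]
variable {ends : E → Sym2 V} {o a₁ a₂ b a₃ : V} {e₁ e₂ eo eb : E}

/-- The law with the four edges at `a₃` closed. -/
def pin4 (p : E → R) (e₁ e₂ eo eb : E) : E → R :=
  Function.update (Function.update (Function.update (Function.update p e₁ 0) e₂ 0) eo 0) eb 0

omit [Fintype E] in
/-- `base4` of a closed configuration is itself. -/
lemma base4_eq_self {ω : Config E} (h1 : ω e₁ = false) (h2 : ω e₂ = false) (ho : ω eo = false)
    (hb : ω eb = false) : base4 e₁ e₂ eo eb ω = ω := by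
  funext e
  unfold base4
  by_cases heb : e = eb
  · rw [heb, Function.update_self, hb]
  rw [Function.update_of_ne heb]
  by_cases heo : e = eo
  · rw [heo, Function.update_self, ho]
  rw [Function.update_of_ne heo]
  by_cases he2 : e = e₂
  · rw [he2, Function.update_self, h2]
  rw [Function.update_of_ne he2]
  by_cases he1 : e = e₁
  · rw [he1, Function.update_self, h1]
  rw [Function.update_of_ne he1]

omit [Fintype E] in
/-- `base4` is idempotent. -/
lemma base4_base4 (h : IsMarkedStarAt ends o a₁ a₂ b a₃ e₁ e₂ eo eb) (ω : Config E) :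
    base4 e₁ e₂ eo eb (base4 e₁ e₂ eo eb ω) = base4 e₁ e₂ eo eb ω :=
  base4_eq_self (base4_e1 h ω) (base4_e2 h ω) (base4_eo h ω) (base4_eb ω)

omit [Fintype E] in
/-- `open4` from `ω` directly: the four updates on `ω` itself. -/
lemma open4_eq (h : IsMarkedStarAt ends o a₁ a₂ b a₃ e₁ e₂ eo eb) (c₁ c₂ co cb : Bool) (ω : Config E) :
    open4 e₁ e₂ eo eb c₁ c₂ co cb ω =
      Function.update (Function.update (Function.update (Function.update ω eb cb) eo co) e₂ c₂) e₁ c₁ := by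
  funext e
  unfold open4 base4
  by_cases he1 : e = e₁
  · rw [he1, Function.update_of_ne h.ne_1b, Function.update_of_ne h.ne_1o, Function.update_of_ne h.ne_12,
      Function.update_self, Function.update_self]
  rw [Function.update_of_ne he1]
  by_cases he2 : e = e₂
  · rw [he2, Function.update_of_ne h.ne_2b, Function.update_of_ne h.ne_2o, Function.update_self,
      Function.update_self]
  rw [Function.update_of_ne he2]
  by_cases heo : e = eo
  · rw [heo, Function.update_of_ne h.ne_ob, Function.update_self, Function.update_self]
  rw [Function.update_of_ne heo]
  by_cases heb : e = eb
  · rw [heb, Function.update_self, Function.update_self]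
  rw [Function.update_of_ne heb, Function.update_of_ne heb, Function.update_of_ne heo,
    Function.update_of_ne he2, Function.update_of_ne he1, Function.update_of_ne heb,
    Function.update_of_ne heo, Function.update_of_ne he2, Function.update_of_ne he1]

omit [Fintype E] in
/-- `open4` from the base is `open4` from `ω`. -/
lemma open4_base4 (h : IsMarkedStarAt ends o a₁ a₂ b a₃ e₁ e₂ eo eb) (c₁ c₂ co cb : Bool) (ω : Config E) :
    open4 e₁ e₂ eo eb c₁ c₂ co cb (base4 e₁ e₂ eo eb ω) = open4 e₁ e₂ eo eb c₁ c₂ co cb ω := by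
  unfold open4
  rw [base4_base4 h]

/-- The `pin4`-expectation of `g` is the `p`-expectation of `g ∘ base4`. -/
lemma expect_pin4 (p : E → R) (g : Config E → R) :
    expect (pin4 p e₁ e₂ eo eb) g = expect p (fun ω => g (base4 e₁ e₂ eo eb ω)) := by
  unfold pin4
  rw [expect_update_zero, expect_update_zero, expect_update_zero, expect_update_zero]
  rfl

/-- **The quadruple pinning**: `E_p[f]` as the sixteen-term mixture over the states of the four edges
at `a₃`, each term an expectation under `pin4 p` of `f` at the re-opened configuration. -/
theorem expect_fourPin (p : E → R) (h : IsMarkedStarAt ends o a₁ a₂ b a₃ e₁ e₂ eo eb)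
    (f : Config E → R) :
    expect p f =
      p e₁ * p e₂ * p eo * p eb * expect (pin4 p e₁ e₂ eo eb) (fun ω => f (open4 e₁ e₂ eo eb true true true true ω)) +
      p e₁ * p e₂ * p eo * (1 - p eb) * expect (pin4 p e₁ e₂ eo eb) (fun ω => f (open4 e₁ e₂ eo eb true true true false ω)) +
      p e₁ * p e₂ * (1 - p eo) * p eb * expect (pin4 p e₁ e₂ eo eb) (fun ω => f (open4 e₁ e₂ eo eb true true false true ω)) +
      p e₁ * p e₂ * (1 - p eo) * (1 - p eb) * expect (pin4 p e₁ e₂ eo eb) (fun ω => f (open4 e₁ e₂ eo eb true true false false ω)) +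
      p e₁ * (1 - p e₂) * p eo * p eb * expect (pin4 p e₁ e₂ eo eb) (fun ω => f (open4 e₁ e₂ eo eb true false true true ω)) +
      p e₁ * (1 - p e₂) * p eo * (1 - p eb) * expect (pin4 p e₁ e₂ eo eb) (fun ω => f (open4 e₁ e₂ eo eb true false true false ω)) +
      p e₁ * (1 - p e₂) * (1 - p eo) * p eb * expect (pin4 p e₁ e₂ eo eb) (fun ω => f (open4 e₁ e₂ eo eb true false false true ω)) +
      p e₁ * (1 - p e₂) * (1 - p eo) * (1 - p eb) * expect (pin4 p e₁ e₂ eo eb) (fun ω => f (open4 e₁ e₂ eo eb true false false false ω)) +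
      (1 - p e₁) * p e₂ * p eo * p eb * expect (pin4 p e₁ e₂ eo eb) (fun ω => f (open4 e₁ e₂ eo eb false true true true ω)) +
      (1 - p e₁) * p e₂ * p eo * (1 - p eb) * expect (pin4 p e₁ e₂ eo eb) (fun ω => f (open4 e₁ e₂ eo eb false true true false ω)) +
      (1 - p e₁) * p e₂ * (1 - p eo) * p eb * expect (pin4 p e₁ e₂ eo eb) (fun ω => f (open4 e₁ e₂ eo eb false true false true ω)) +
      (1 - p e₁) * p e₂ * (1 - p eo) * (1 - p eb) * expect (pin4 p e₁ e₂ eo eb) (fun ω => f (open4 e₁ e₂ eo eb false true false false ω)) +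
      (1 - p e₁) * (1 - p e₂) * p eo * p eb * expect (pin4 p e₁ e₂ eo eb) (fun ω => f (open4 e₁ e₂ eo eb false false true true ω)) +
      (1 - p e₁) * (1 - p e₂) * p eo * (1 - p eb) * expect (pin4 p e₁ e₂ eo eb) (fun ω => f (open4 e₁ e₂ eo eb false false true false ω)) +
      (1 - p e₁) * (1 - p e₂) * (1 - p eo) * p eb * expect (pin4 p e₁ e₂ eo eb) (fun ω => f (open4 e₁ e₂ eo eb false false false true ω)) +
      (1 - p e₁) * (1 - p e₂) * (1 - p eo) * (1 - p eb) * expect (pin4 p e₁ e₂ eo eb) (fun ω => f (open4 e₁ e₂ eo eb false false false false ω)) := by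
  have key : ∀ c₁ c₂ co cb : Bool, expect (pin4 p e₁ e₂ eo eb)
      (fun ω => f (open4 e₁ e₂ eo eb c₁ c₂ co cb ω)) =
      expect p (fun ω => f (Function.update (Function.update (Function.update (Function.update ω eb cb)
        eo co) e₂ c₂) e₁ c₁)) := by
    intro c₁ c₂ co cb
    rw [expect_pin4]
    congr 1
    funext ω
    rw [open4_base4 h, open4_eq h]
  simp only [key]
  simp only [expect_eq_update_pin p f e₁,
    expect_eq_update_pin p (fun ω => f (Function.update ω e₁ true)) e₂,
    expect_eq_update_pin p (fun ω => f (Function.update ω e₁ false)) e₂,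
    expect_eq_update_pin p (fun ω => f (Function.update (Function.update ω e₂ true) e₁ true)) eo,
    expect_eq_update_pin p (fun ω => f (Function.update (Function.update ω e₂ false) e₁ true)) eo,
    expect_eq_update_pin p (fun ω => f (Function.update (Function.update ω e₂ true) e₁ false)) eo,
    expect_eq_update_pin p (fun ω => f (Function.update (Function.update ω e₂ false) e₁ false)) eo,
    expect_eq_update_pin p (fun ω => f (Function.update (Function.update (Function.update ω eo true) e₂ true) e₁ true)) eb,
    expect_eq_update_pin p (fun ω => f (Function.update (Function.update (Function.update ω eo false) e₂ true) e₁ true)) eb,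
    expect_eq_update_pin p (fun ω => f (Function.update (Function.update (Function.update ω eo true) e₂ false) e₁ true)) eb,
    expect_eq_update_pin p (fun ω => f (Function.update (Function.update (Function.update ω eo false) e₂ false) e₁ true)) eb,
    expect_eq_update_pin p (fun ω => f (Function.update (Function.update (Function.update ω eo true) e₂ true) e₁ false)) eb,
    expect_eq_update_pin p (fun ω => f (Function.update (Function.update (Function.update ω eo false) e₂ true) e₁ false)) eb,
    expect_eq_update_pin p (fun ω => f (Function.update (Function.update (Function.update ω eo true) e₂ false) e₁ false)) eb,
    expect_eq_update_pin p (fun ω => f (Function.update (Function.update (Function.update ω eo false) e₂ false) e₁ false)) eb]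
  ring

/-- Functions agreeing where the four pinned edges are closed have the same `pin4`-expectation. -/
lemma expect_pin4_congr (p : E → R) (h : IsMarkedStarAt ends o a₁ a₂ b a₃ e₁ e₂ eo eb)
    (f g : Config E → R)
    (hfg : ∀ ω : Config E, ω e₁ = false → ω e₂ = false → ω eo = false → ω eb = false → f ω = g ω) :
    expect (pin4 p e₁ e₂ eo eb) f = expect (pin4 p e₁ e₂ eo eb) g := by
  rw [expect_pin4, expect_pin4]
  congr 1
  funext ω
  exact hfg _ (base4_e1 h ω) (base4_e2 h ω) (base4_eo h ω) (base4_eb ω)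

/-- The `pin4`-expectation of an indicator at the re-opened configuration is a base probability, given
the pointwise description on the closed configurations. -/
lemma expect_indicator_open4 (p : E → R) (h : IsMarkedStarAt ends o a₁ a₂ b a₃ e₁ e₂ eo eb)
    (c₁ c₂ co cb : Bool) (S T : Set (Config E))
    (hST : ∀ ω : Config E, ω e₁ = false → ω e₂ = false → ω eo = false → ω eb = false →
      (open4 e₁ e₂ eo eb c₁ c₂ co cb ω ∈ S ↔ ω ∈ T)) :
    expect (pin4 p e₁ e₂ eo eb) (fun ω => S.indicator 1 (open4 e₁ e₂ eo eb c₁ c₂ co cb ω)) =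
      prob (pin4 p e₁ e₂ eo eb) T := by
  rw [prob_eq_expect_indicator]
  refine expect_pin4_congr p h _ _ fun ω h1 h2 ho hb => ?_
  by_cases hω : ω ∈ T
  · rw [Set.indicator_of_mem hω, Set.indicator_of_mem ((hST ω h1 h2 ho hb).2 hω)]
    rfl
  · rw [Set.indicator_of_notMem hω, Set.indicator_of_notMem (fun hh => hω ((hST ω h1 h2 ho hb).1 hh))]

/-- **Probabilities by quadruple pinning**: if the event `S` at the sixteen re-opened configurations is
described on the closed configurations by `T₁₁₁₁, …, T₀₀₀₀`, then `P_p(S)` is the mixture of their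
`pin4 p`-probabilities. -/
theorem prob_fourPin (p : E → R) (h : IsMarkedStarAt ends o a₁ a₂ b a₃ e₁ e₂ eo eb)
    (S T1111 T1110 T1101 T1100 T1011 T1010 T1001 T1000 T0111 T0110 T0101 T0100 T0011 T0010 T0001 T0000 : Set (Config E))
    (h1111 : ∀ ω : Config E, ω e₁ = false → ω e₂ = false → ω eo = false → ω eb = false →
      (open4 e₁ e₂ eo eb true true true true ω ∈ S ↔ ω ∈ T1111))
    (h1110 : ∀ ω : Config E, ω e₁ = false → ω e₂ = false → ω eo = false → ω eb = false →
      (open4 e₁ e₂ eo eb true true true false ω ∈ S ↔ ω ∈ T1110))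
    (h1101 : ∀ ω : Config E, ω e₁ = false → ω e₂ = false → ω eo = false → ω eb = false →
      (open4 e₁ e₂ eo eb true true false true ω ∈ S ↔ ω ∈ T1101))
    (h1100 : ∀ ω : Config E, ω e₁ = false → ω e₂ = false → ω eo = false → ω eb = false →
      (open4 e₁ e₂ eo eb true true false false ω ∈ S ↔ ω ∈ T1100))
    (h1011 : ∀ ω : Config E, ω e₁ = false → ω e₂ = false → ω eo = false → ω eb = false →
      (open4 e₁ e₂ eo eb true false true true ω ∈ S ↔ ω ∈ T1011))
    (h1010 : ∀ ω : Config E, ω e₁ = false → ω e₂ = false → ω eo = false → ω eb = false →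
      (open4 e₁ e₂ eo eb true false true false ω ∈ S ↔ ω ∈ T1010))
    (h1001 : ∀ ω : Config E, ω e₁ = false → ω e₂ = false → ω eo = false → ω eb = false →
      (open4 e₁ e₂ eo eb true false false true ω ∈ S ↔ ω ∈ T1001))
    (h1000 : ∀ ω : Config E, ω e₁ = false → ω e₂ = false → ω eo = false → ω eb = false →
      (open4 e₁ e₂ eo eb true false false false ω ∈ S ↔ ω ∈ T1000))
    (h0111 : ∀ ω : Config E, ω e₁ = false → ω e₂ = false → ω eo = false → ω eb = false →
      (open4 e₁ e₂ eo eb false true true true ω ∈ S ↔ ω ∈ T0111))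
    (h0110 : ∀ ω : Config E, ω e₁ = false → ω e₂ = false → ω eo = false → ω eb = false →
      (open4 e₁ e₂ eo eb false true true false ω ∈ S ↔ ω ∈ T0110))
    (h0101 : ∀ ω : Config E, ω e₁ = false → ω e₂ = false → ω eo = false → ω eb = false →
      (open4 e₁ e₂ eo eb false true false true ω ∈ S ↔ ω ∈ T0101))
    (h0100 : ∀ ω : Config E, ω e₁ = false → ω e₂ = false → ω eo = false → ω eb = false →
      (open4 e₁ e₂ eo eb false true false false ω ∈ S ↔ ω ∈ T0100))
    (h0011 : ∀ ω : Config E, ω e₁ = false → ω e₂ = false → ω eo = false → ω eb = false →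
      (open4 e₁ e₂ eo eb false false true true ω ∈ S ↔ ω ∈ T0011))
    (h0010 : ∀ ω : Config E, ω e₁ = false → ω e₂ = false → ω eo = false → ω eb = false →
      (open4 e₁ e₂ eo eb false false true false ω ∈ S ↔ ω ∈ T0010))
    (h0001 : ∀ ω : Config E, ω e₁ = false → ω e₂ = false → ω eo = false → ω eb = false →
      (open4 e₁ e₂ eo eb false false false true ω ∈ S ↔ ω ∈ T0001))
    (h0000 : ∀ ω : Config E, ω e₁ = false → ω e₂ = false → ω eo = false → ω eb = false →
      (open4 e₁ e₂ eo eb false false false false ω ∈ S ↔ ω ∈ T0000)) :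
    prob p S =
      p e₁ * p e₂ * p eo * p eb * prob (pin4 p e₁ e₂ eo eb) T1111 +
      p e₁ * p e₂ * p eo * (1 - p eb) * prob (pin4 p e₁ e₂ eo eb) T1110 +
      p e₁ * p e₂ * (1 - p eo) * p eb * prob (pin4 p e₁ e₂ eo eb) T1101 +
      p e₁ * p e₂ * (1 - p eo) * (1 - p eb) * prob (pin4 p e₁ e₂ eo eb) T1100 +
      p e₁ * (1 - p e₂) * p eo * p eb * prob (pin4 p e₁ e₂ eo eb) T1011 +
      p e₁ * (1 - p e₂) * p eo * (1 - p eb) * prob (pin4 p e₁ e₂ eo eb) T1010 +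
      p e₁ * (1 - p e₂) * (1 - p eo) * p eb * prob (pin4 p e₁ e₂ eo eb) T1001 +
      p e₁ * (1 - p e₂) * (1 - p eo) * (1 - p eb) * prob (pin4 p e₁ e₂ eo eb) T1000 +
      (1 - p e₁) * p e₂ * p eo * p eb * prob (pin4 p e₁ e₂ eo eb) T0111 +
      (1 - p e₁) * p e₂ * p eo * (1 - p eb) * prob (pin4 p e₁ e₂ eo eb) T0110 +
      (1 - p e₁) * p e₂ * (1 - p eo) * p eb * prob (pin4 p e₁ e₂ eo eb) T0101 +
      (1 - p e₁) * p e₂ * (1 - p eo) * (1 - p eb) * prob (pin4 p e₁ e₂ eo eb) T0100 +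
      (1 - p e₁) * (1 - p e₂) * p eo * p eb * prob (pin4 p e₁ e₂ eo eb) T0011 +
      (1 - p e₁) * (1 - p e₂) * p eo * (1 - p eb) * prob (pin4 p e₁ e₂ eo eb) T0010 +
      (1 - p e₁) * (1 - p e₂) * (1 - p eo) * p eb * prob (pin4 p e₁ e₂ eo eb) T0001 +
      (1 - p e₁) * (1 - p e₂) * (1 - p eo) * (1 - p eb) * prob (pin4 p e₁ e₂ eo eb) T0000 := by
  rw [prob_eq_expect_indicator, expect_fourPin p h, expect_indicator_open4 p h true true true true S T1111 h1111,
    expect_indicator_open4 p h true true true false S T1110 h1110,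
    expect_indicator_open4 p h true true false true S T1101 h1101,
    expect_indicator_open4 p h true true false false S T1100 h1100,
    expect_indicator_open4 p h true false true true S T1011 h1011,
    expect_indicator_open4 p h true false true false S T1010 h1010,
    expect_indicator_open4 p h true false false true S T1001 h1001,
    expect_indicator_open4 p h true false false false S T1000 h1000,
    expect_indicator_open4 p h false true true true S T0111 h0111,
    expect_indicator_open4 p h false true true false S T0110 h0110,
    expect_indicator_open4 p h false true false true S T0101 h0101,
    expect_indicator_open4 p h false true false false S T0100 h0100,
    expect_indicator_open4 p h false false true true S T0011 h0011,
    expect_indicator_open4 p h false false true false S T0010 h0010,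
    expect_indicator_open4 p h false false false true S T0001 h0001,
    expect_indicator_open4 p h false false false false S T0000 h0000]

end Pin4

end CaseOne

end Summit.Ventures.PercRepro2
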